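import Summits.BirchSwinnertonDyer.Rank1Residual.GaloisImage.KolyvaginLevelOneNineDivides
import HarnessLib

/-!
# END-m1 "nine divides Ш" — the INTERIM form: the injectivity input discharged from the pinned [S24]
# fact until n1011-p11's G5 lands (cell `b2b-bsdres`, team n1011, ROUTE-1 §33.3 sub-target R1-57,
# FILE A part 2; row T-R1-57-A, seat p09 GEN 6; skeleton `cells/n1011/skel/T-R1-57-A.md` §C)

HONEST FRAMING (cell `b2b-bsdres`, run/shared/lean/b2b/bsd-rank1-residual/, verbatim in every
file): the goal of the cell is to DELETE the COMBINATION-SHAPED residual classes of the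
Birch–Swinnerton-Dyer formula for ALL analytic-rank `≤ 1` elliptic curves over `ℚ` — "full BSD
formula for every rank `≤ 1` curve in class `C`" assembled STRICTLY from published theorems — so
that the rank-`≤ 1` remainder becomes exactly the CONSTRUCTION-SHAPED classes, which are TYPED
(missing-input `Prop`s), NOT attempted. This is not "finishing BSD". Team n1011: research route on
the CONSTRUCTION-SHAPED class X4 (§I N11, class A1); no claim beyond the stated classes; nothing
booked; no mark / label moved. Theorems only: no definition, no named fact, no `sorry`. The two
theorems here are CONDITIONAL on the pinned named fact
`Sakamoto2024.kolyvaginSystems_freeRankOne_zmod_three_pow` (`hS24`, [S24] Thm. 4.4 (1)) — the INTERIM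
supplier of the injectivity hypothesis `hinj` of `KolyvaginLevelOneNineDivides`; when n1011-p11's END
G5 `CoreRankOne.apply_eq_zero_of_apply_core_eq_zero` lands, `hinj` is discharged by it at `n₀ = ∅`
and END-m1 carries NO [S24] binder.

* `kolyvaginSystem_eq_zero_of_apply_empty_eq_zero_of_S24` — injectivity at the core vertex `∅` from
  the bijectivity clause of n1011-p13's LANDED residual instance
  `kolyvaginSystems_freeRankOne_propagatedSelmerStructureOne_of_surj` (`λ*(∅) = log₃ #H¹_{𝓕̄_can^*} = 0`
  when that group is trivial).
* `exists_ne_zero_mem_selmerGroup_three_of_dictionaryOne_of_levelOne_certificate_of_S24` — END-m1 with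
  `hinj` so discharged (binders: the main theorem's + the `τ`-datum, `hunro`, the admissible `S` with
  its infinite places, the datum's shape `η hP hT hD`, and `hS24`).

References: [Sakamoto2024] Thm. 4.4 (1) (p. 926); [Rubin2011] Cor. 2.8.9 (p. 25); r1 ROUTE-1 §33.3.
-/

noncomputable section

open scoped Classical NumberField ContRepresentation
open Field NumberField IsDedekindDomain
open WeierstrassCurve Literature.NumberTheory.EllipticCurves Literature.NumberTheory.EllipticCurves.ModularForms
  Literature.NumberTheory.EllipticCurves.Rank1Residual
  Literature.NumberTheory.EllipticCurves.Rank1Residual.Typed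
  Literature.NumberTheory.GaloisRepresentations
  Literature.NumberTheory.GaloisRepresentations.DiscreteGaloisModule Literature.NumberTheory.GaloisCohomology
open Literature.NumberTheory.DiophantineGeometry.Dioph (ratModP)

namespace Summit.BirchSwinnertonDyer.Rank1Residual.GaloisImage

variable (W : WeierstrassCurve ℚ) [W.IsElliptic]

/-! ## §C. The interim: `hinj` from the pinned [S24] fact (until n1011-p11's G5 lands) -/

/-- **Injectivity at the core vertex `∅` from the pinned fact [S24] Thm. 4.4 (1)** (the INTERIM for
`hinj`; to be replaced by n1011-p11's G5 `CoreRankOne.apply_eq_zero_of_apply_core_eq_zero … ∅` when it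
lands): n1011-p13's LANDED residual instance
`kolyvaginSystems_freeRankOne_propagatedSelmerStructureOne_of_surj` gives, at the level `∅` with
`H¹_{𝓕̄_can^*}(ℚ, E[3]^∨(1)) = 0` (so `λ*(∅) = log₃ 1 = 0`), the bijectivity of `κ ↦ κ_∅` on
`KS₁(E[3], 𝓕̄_can, 𝒫(τ))`; a Kolyvagin system with `κ_∅ = 0` is then `0`.  CONDITIONAL on `hS24`.
[cite: Sakamoto2024, Thm. 4.4 (1) (p. 926)] [cite: Rubin2011, Cor. 2.8.9 (p. 25)] -/
theorem kolyvaginSystem_eq_zero_of_apply_empty_eq_zero_of_S24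
    (hS24 : Sakamoto2024.kolyvaginSystems_freeRankOne_zmod_three_pow)
    [Finite (geomTorsion W ((3 : ℕ) : ℤ))]
    (h3 : W.HasSurjectiveModNGaloisRep ((3 : ℕ) : ℤ))
    (τ : absoluteGaloisGroup ℚ) (hτμ : τ ∈ rootsOfUnityFixer ℚ 3)
    (hτq : Nonempty (cokerSubOne (W.torsionGaloisModule ((3 : ℕ) : ℤ)) τ ≃+ ZMod 3))
    (inv : LocalInvariants ℚ 3) (hperf : inv.IsPerfect) (hsum : inv.SumLocalTermEqZero)
    (hunro : inv.UnramifiedOrthogonal) (hcompl : inv.SelmerComplement)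
    (hEP : ∀ v : HeightOneSpectrum (𝓞 ℚ), localEulerPoincareCharacteristic (v.adicCompletion ℚ))
    (S : Finset (Place ℚ)) (hS : ∀ w : InfinitePlace ℚ, (Sum.inl w : Place ℚ) ∈ S)
    (h3S : ∀ v : HeightOneSpectrum (𝓞 ℚ), ((3 : ℕ) : 𝓞 ℚ) ∈ v.asIdeal → (Sum.inr v : Place ℚ) ∈ S)
    (hbadS : ∀ v : HeightOneSpectrum (𝓞 ℚ), ¬ W.HasGoodReductionAt v → (Sum.inr v : Place ℚ) ∈ S)
    (D : KolyvaginDatum (W.torsionGaloisModule ((3 : ℕ) : ℤ)))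
    (η : (q : HeightOneSpectrum (𝓞 ℚ)) → (ZMod (Ideal.absNorm q.asIdeal))ˣ)
    (hP : D.primes = frobeniusClassPrimes (W.torsionGaloisModule ((3 : ℕ) : ℤ))
      {v | (Sum.inr v : Place ℚ) ∈ S} τ 3)
    (hT : D.transverse = cyclotomicTransverse (W.torsionGaloisModule ((3 : ℕ) : ℤ)))
    (hD : D.HasCanonicalComparison 3 η) :
    ∀ κ : Finset (HeightOneSpectrum (𝓞 ℚ)) → galoisCohomology (W.torsionGaloisModule ((3 : ℕ) : ℤ)) 1,
      D.IsKolyvaginSystem (propagatedSelmerStructureOne W 3) κ →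
      (inv.dualSelmerStructure (W.torsionGaloisModule ((3 : ℕ) : ℤ))
        (D.atLevel (propagatedSelmerStructureOne W 3) ∅)).selmerGroup = ⊥ →
      κ ∅ = 0 → ∀ m, κ m = 0 := by
  intro κ hκ hcore hk0 m
  have h1 := kolyvaginSystems_freeRankOne_propagatedSelmerStructureOne_of_surj W hS24 h3 τ hτμ hτq inv
    hperf hsum hunro hcompl hEP S hS h3S hbadS D η hP hT hD
  have hlam : LocalInvariants.lambdaStar inv (D.atLevel (propagatedSelmerStructureOne W 3) ∅) 3 = 0 := by
    unfold LocalInvariants.lambdaStar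
    rw [hcore, AddSubgroup.card_bot, Nat.log_one_right]
  have hbij := h1.2 ∅ D.isLevel_empty hlam
  -- `κ` and `0` have the same image under the bijective evaluation at `∅`
  have hκmem : κ ∈ D.kolyvaginSystems (propagatedSelmerStructureOne W 3) :=
    (KolyvaginDatum.mem_kolyvaginSystems_iff D _ κ).2 hκ
  have heq : (⟨κ, hκmem⟩ : D.kolyvaginSystems (propagatedSelmerStructureOne W 3)) = 0 := by
    apply hbij.1
    apply Subtype.ext
    change κ ∅ = (0 : D.kolyvaginSystems (propagatedSelmerStructureOne W 3)).1 ∅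
    rw [hk0]
    rfl
  have := congrArg (fun z : D.kolyvaginSystems (propagatedSelmerStructureOne W 3) => z.1 m) heq
  simpa using this

/-- **END-m1 with the injectivity input discharged from the pinned [S24] fact** (INTERIM:
`exists_ne_zero_mem_selmerGroup_three_of_dictionaryOne_of_levelOne_certificate` with `hinj` supplied by
`kolyvaginSystem_eq_zero_of_apply_empty_eq_zero_of_S24`; CONDITIONAL on `hS24` until n1011-p11's G5
lands, when the binder swap makes this END [S24]-FREE).  Same binders otherwise, plus `hunro`.
[cite: Sakamoto2024, Thm. 4.4 (1) (p. 926)] [cite: Kim2022StructureSelmer, Thm. 3.13]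
[cite: Rubin2011, Thm. 2.8.4 and Cor. 2.8.9 (pp. 25–26)] -/
theorem exists_ne_zero_mem_selmerGroup_three_of_dictionaryOne_of_levelOne_certificate_of_S24
    (hS24 : Sakamoto2024.kolyvaginSystems_freeRankOne_zmod_three_pow)
    [W.IsGloballyMinimal] [Finite (geomTorsion W ((3 : ℕ) : ℤ))]
    (h3 : W.HasSurjectiveModNGaloisRep ((3 : ℕ) : ℤ))
    (τ : absoluteGaloisGroup ℚ) (hτμ : τ ∈ rootsOfUnityFixer ℚ 3)
    (hτq : Nonempty (cokerSubOne (W.torsionGaloisModule ((3 : ℕ) : ℤ)) τ ≃+ ZMod 3))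
    (inv : LocalInvariants ℚ 3) (hperf : inv.IsPerfect) (hsum : inv.SumLocalTermEqZero)
    (hunro : inv.UnramifiedOrthogonal) (hcompl : inv.SelmerComplement)
    (hEP : ∀ v : HeightOneSpectrum (𝓞 ℚ), localEulerPoincareCharacteristic (v.adicCompletion ℚ))
    (S : Finset (Place ℚ)) (hS : ∀ w : InfinitePlace ℚ, (Sum.inl w : Place ℚ) ∈ S)
    (h3S : ∀ v : HeightOneSpectrum (𝓞 ℚ), ((3 : ℕ) : 𝓞 ℚ) ∈ v.asIdeal → (Sum.inr v : Place ℚ) ∈ S)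
    (hbadS : ∀ v : HeightOneSpectrum (𝓞 ℚ), ¬ W.HasGoodReductionAt v → (Sum.inr v : Place ℚ) ∈ S)
    (D : KolyvaginDatum (W.torsionGaloisModule ((3 : ℕ) : ℤ)))
    (η : (q : HeightOneSpectrum (𝓞 ℚ)) → (ZMod (Ideal.absNorm q.asIdeal))ˣ)
    (hP : D.primes = frobeniusClassPrimes (W.torsionGaloisModule ((3 : ℕ) : ℤ))
      {v | (Sum.inr v : Place ℚ) ∈ S} τ 3)
    (hT : D.transverse = cyclotomicTransverse (W.torsionGaloisModule ((3 : ℕ) : ℤ)))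
    (hD : D.HasCanonicalComparison 3 η)
    (v₃ : HeightOneSpectrum (𝓞 ℚ)) (hv₃ : ((3 : ℕ) : 𝓞 ℚ) ∈ v₃.asIdeal)
    (hDict : KatoKuriharaDictionaryThreeOneAt W 0 D v₃)
    (hX : Addv W 3) (hc3 : ¬ 3 ∣ (W.baseChange ℚ_[3]).localTamagawaNumber ℤ_[3])
    (ht : Nat.card {Q : (W.baseChange ℚ_[3]).toAffine.Point // (3 : ℕ) • Q = 0} = 1)
    {N : ℕ} [NeZero N] (P : ModularParametrizationData W N)
    (hManin : ¬ ((3 : ℕ) : ℤ) ∣ P.maninConstant)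
    (hΩ : ∃ u : ℚ, ‖(u : ℚ_[3])‖ = 1 ∧ W.realPeriodRat = u * plusPeriod P.f)
    (hzero : ratModP 3 (ratPlusSymbol P.f 0) = 0)
    (n : Finset (HeightOneSpectrum (𝓞 ℚ))) (hn : D.IsLevel n)
    {ψ₀ : (ℓ : ℕ) → (ZMod ℓ)ˣ →* Multiplicative (ZMod 3)}
    (hψ₀ : ∀ q ∈ n, Function.Surjective (ψ₀ (Ideal.absNorm q.asIdeal)))
    (hcert : haveI : NeZero (∏ q ∈ n, Ideal.absNorm q.asIdeal) :=
        ⟨Finset.prod_ne_zero_iff.2 fun q _ => Assembly.absNorm_ne_zero q⟩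
      kuriharaNumber P.f 3 (∏ q ∈ n, Ideal.absNorm q.asIdeal) ψ₀ ≠ 0) :
    ∃ x ∈ (W.kummerSelmerStructure ((3 : ℕ) : ℤ)).selmerGroup, x ≠ 0 :=
  exists_ne_zero_mem_selmerGroup_three_of_dictionaryOne_of_levelOne_certificate W h3 inv hperf hsum
    hcompl hEP S h3S hbadS D v₃ hv₃ hDict hX hc3 ht P hManin hΩ hzero n hn hψ₀ hcert
    (kolyvaginSystem_eq_zero_of_apply_empty_eq_zero_of_S24 W hS24 h3 τ hτμ hτq inv hperf hsum hunro
      hcompl hEP S hS h3S hbadS D η hP hT hD)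

end Summit.BirchSwinnertonDyer.Rank1Residual.GaloisImage

end
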